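import Summits.CriticalPhenomena.PercolationContinuityZ3.Theorems.PercNearOneGluingNoHeavyLowerTailSahiThreeCopyMatrixSandwich
import Summits.CriticalPhenomena.PercolationContinuityZ3.Theorems.PercNearOneGluingNoHeavyLowerTailSahiThreeCopyTwoPointRefutation

/-!
# `NoHeavyLowerTail` (crux stmt-CriticalPhenomena-4575), Sahi programme: **NOT EVEN A MATRIX SANDWICH EXISTS FOR `C₈`** — the entrywise-
# nonnegative matrix certificate of `…SahiThreeCopyMatrixSandwich` (all pairwise three-copy Harris slack) is unsatisfiable for
# `C₈ = (x₀∨x₁)(x₂∨x₃)(x₄∨x₅)(x₆∨x₇)` at the front profile `π ≡ 1`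

Support file (Sahi cell, seat `prim-sahi-p1`, generation 60; `--supports stmt-CriticalPhenomena-4575`).  COMPUTATIONAL: six more integer
constants (`native_decide`, 65 536-term sums) and one pointwise count over `{0,1}^8 × {0,1}^8`; everything else standard axioms.  Companion
of `…TwoPointRefutation` (`not_twoPoint_C8`: no DIAGONAL certificate) and `…MatrixSandwich` (`tc_frontFn_nonneg_of_matrixSandwich_upSets`:
matrix certificates suffice).

THE ARGUMENT (memo FROM-prim-sahi-p1-gen60 §4/§8; pairs `p = {a_p, b_p} = {x_{2p}, x_{2p+1}}`).  A matrix certificate `S ≥ 0` must satisfy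
(L) `S(↑b_p × ↑a_p) ≥ R(↑b_p, ↑a_p) = 250` for each of the four pairs (these pairs are 3C-tight), (U) `S(↑{b_p,b_q} × ↑{a_p,a_q}) ≤ c(Z_{pq}) = 50`
for the six `p < q`, and (U) `S(L × L) ≤ c(L) = 625`.  For a pair of levels `(e, e′)` let `s = #{p : b_p ∈ e, a_p ∈ e′}`; it is counted `s` times by
the (L) rows and `C(s,2)` times by the pair rows, and `s − C(s,2) ≤ 1` for `s = 0,…,4`.  Hence, `S` being entrywise nonnegative,
`1000 − 300 ≤ Σ_p S(↑b_p×↑a_p) − Σ_{p<q} S(↑b_pb_q × ↑a_pa_q) ≤ S(L×L) ≤ 625`, i.e. `700 ≤ 625`: contradiction (`not_matrixSandwich_C8`).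
So for ANDs of ≥ 3 disjoint ORs the whole "pairwise Harris" certificate family (TP₀ ⊂ TP₀′) is void; 3C-SAHI for these slots is untouched.
[this work]
-/

namespace Summit.CriticalPhenomena.PercolationContinuityZ3.Theorems.SahiThreeCopy

open Finset Function Literature.Combinatorics.Sahi2008
open scoped BigOperators

/-! ### §1 The `θ`-free forms are the matrix-sandwich forms `A₁`, `A₂`; weights form of `S(·,·)` -/

section General

variable {k : ℕ}

/-- `A₁ = N1form` at `θ ≡ 0`. [this work] -/
theorem A1form_eq_N1form_zero (π : Fin k → ℕ) (f φ ψ : Pt k → ℝ) : A1form k π f φ ψ = N1form k π f (fun _ _ _ => 0) φ ψ := by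
  unfold A1form N1form; exact sum_congr rfl fun σ _ => by ring

/-- `A₂ = N2form` at `θ ≡ 0`. [this work] -/
theorem A2form_eq_N2form_zero (π : Fin k → ℕ) (f φ ψ : Pt k → ℝ) : A2form k π f φ ψ = N2form k π f (fun _ _ _ => 0) φ ψ := by
  unfold A2form N2form; exact sum_congr rfl fun σ _ => by ring

/-- `S(·,·)` against a general pair weight. [this work] -/
noncomputable def SformW (S : Pt k → Pt k → ℝ) (w : Pt k × Pt k → ℝ) : ℝ := ∑ p : Pt k × Pt k, S p.1 p.2 * w p

/-- `S(φ,ψ) = SformW S (φ ⊗ ψ)`. [this work] -/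
theorem Sform_eq_SformW (S : Pt k → Pt k → ℝ) (φ ψ : Pt k → ℝ) : Sform S φ ψ = SformW S (fun p => φ p.1 * ψ p.2) := rfl

/-- `SformW` is additive in the weight. [this work] -/
theorem SformW_add (S : Pt k → Pt k → ℝ) (w w' : Pt k × Pt k → ℝ) : SformW S (w + w') = SformW S w + SformW S w' := by
  unfold SformW; rw [← sum_add_distrib]; exact sum_congr rfl fun p _ => by simp only [Pi.add_apply]; ring

/-- `SformW` of a finite sum of weights. [this work] -/
theorem SformW_listSum (S : Pt k → Pt k → ℝ) (l : List (Pt k × Pt k → ℝ)) : (l.map (SformW S)).sum = SformW S l.sum := by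
  induction l with
  | nil => simp [SformW]
  | cons w l ih => rw [List.map_cons, List.sum_cons, List.sum_cons, SformW_add, ih]

/-- `SformW` is monotone in the weight for `S ≥ 0`. [this work] -/
theorem SformW_mono {S : Pt k → Pt k → ℝ} (hS : ∀ e e', 0 ≤ S e e') {w w' : Pt k × Pt k → ℝ} (hw : ∀ p, w p ≤ w' p) :
    SformW S w ≤ SformW S w' := by
  unfold SformW; exact sum_le_sum fun p _ => mul_le_mul_of_nonneg_left (hw p) (hS _ _)

end General

/-! ### §2 The six pair-box constants (computational) -/

/-- `c(Z_{01}) = 50` as the box value `A₁(1_{↑x₁x₃}, 1_{↑x₀x₂})`. [this work] -/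
theorem c0Z_box01 : c0Z piOne8 c8B (cylB [1, 3]) (cylB [0, 2]) = 50 := by native_decide
/-- `c(Z_{02}) = 50` (box form). [this work] -/
theorem c0Z_box02 : c0Z piOne8 c8B (cylB [1, 5]) (cylB [0, 4]) = 50 := by native_decide
/-- `c(Z_{03}) = 50` (box form). [this work] -/
theorem c0Z_box03 : c0Z piOne8 c8B (cylB [1, 7]) (cylB [0, 6]) = 50 := by native_decide
/-- `c(Z_{12}) = 50` (box form). [this work] -/
theorem c0Z_box12 : c0Z piOne8 c8B (cylB [3, 5]) (cylB [2, 4]) = 50 := by native_decide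
/-- `c(Z_{13}) = 50` (box form). [this work] -/
theorem c0Z_box13 : c0Z piOne8 c8B (cylB [3, 7]) (cylB [2, 6]) = 50 := by native_decide
/-- `c(Z_{23}) = 50` (box form). [this work] -/
theorem c0Z_box23 : c0Z piOne8 c8B (cylB [5, 7]) (cylB [4, 6]) = 50 := by native_decide

/-! ### §3 The pointwise count on pairs of levels and the refutation -/

/-- Weight of a box `↑S × ↑S'` at a pair of levels. [this work] -/
noncomputable def wBox (S S' : List (Fin 8)) (p : Pt 8 × Pt 8) : ℝ := setInd (cyl S) p.1 * setInd (cyl S') p.2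

/-- The four (L) boxes `(↑b_p, ↑a_p)`. [this work] -/
def boxesL : List (List (Fin 8) × List (Fin 8)) := [([1], [0]), ([3], [2]), ([5], [4]), ([7], [6])]

/-- The six (U) pair boxes `(↑b_pb_q, ↑a_pa_q)`. [this work] -/
def boxesU : List (List (Fin 8) × List (Fin 8)) :=
  [([1, 3], [0, 2]), ([1, 5], [0, 4]), ([1, 7], [0, 6]), ([3, 5], [2, 4]), ([3, 7], [2, 6]), ([5, 7], [4, 6])]

/-- Number of boxes of a list containing the pair `(e, e′)`. [this work] -/
def boxCount (boxes : List (List (Fin 8) × List (Fin 8))) (p : Pt 8 × Pt 8) : ℕ :=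
  (boxes.filter fun b => cylB b.1 p.1 && cylB b.2 p.2).length

/-- ★ The pointwise count: `s − C(s,2) ≤ 1`, i.e. `#(L boxes ∋ (e,e′)) ≤ 1 + #(U pair boxes ∋ (e,e′))`. [this work] -/
theorem boxCount_dominate : ∀ p : Pt 8 × Pt 8, boxCount boxesL p ≤ 1 + boxCount boxesU p := by native_decide

/-- The weight sum of a box list at a pair equals the box count. [this work] -/
theorem sum_wBox_eq (boxes : List (List (Fin 8) × List (Fin 8))) (p : Pt 8 × Pt 8) :
    (boxes.map fun b => wBox b.1 b.2 p).sum = (boxCount boxes p : ℝ) := by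
  induction boxes with
  | nil => simp [boxCount]
  | cons b bs ih =>
    simp only [List.map_cons, List.sum_cons, ih, boxCount, List.filter_cons]
    have h1 : wBox b.1 b.2 p = if (cylB b.1 p.1 && cylB b.2 p.2) = true then 1 else 0 := by
      simp only [wBox, cyl, setInd_filter_eq, Bool.and_eq_true]
      by_cases ha : cylB b.1 p.1 = true <;> by_cases hb : cylB b.2 p.2 = true <;> simp [ha, hb]
    rw [h1]
    split_ifs with h
    · simp only [List.length_cons]; push_cast; ring
    · simp

/-- `SformW` summed over a box list is `SformW` of the box-count weight. [this work] -/
theorem SformW_boxes (S : Pt 8 → Pt 8 → ℝ) (boxes : List (List (Fin 8) × List (Fin 8))) :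
    (boxes.map fun b => SformW S (wBox b.1 b.2)).sum = SformW S (fun p => (boxCount boxes p : ℝ)) := by
  induction boxes with
  | nil =>
    simp only [List.map_nil, List.sum_nil, boxCount, List.filter_nil, List.length_nil, Nat.cast_zero]
    simp [SformW]
  | cons b bs ih =>
    rw [List.map_cons, List.sum_cons, ih, ← SformW_add]
    congr 1
    funext p
    have := sum_wBox_eq (b :: bs) p
    rw [List.map_cons, List.sum_cons, sum_wBox_eq] at this
    simpa only [Pi.add_apply] using this

/-- ★★★ **NO MATRIX-SANDWICH CERTIFICATE FOR `C₈` AT `π ≡ 1`.**  The hypotheses of `tc_frontFn_nonneg_of_matrixSandwich_upSets` (an entrywise-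
nonnegative `S` with `R(V,W) ≤ S(1_V,1_W) ≤ c(V∩W)` for all up-sets `V, W`) are unsatisfiable for `k = 8`, `π ≡ 1`, `f = 1_{C₈}`; a fortiori
(`Sform_diag_eq`) so is the diagonal two-point certificate (`not_twoPoint_C8`). [this work] -/
theorem not_matrixSandwich_C8 :
    ¬ ∃ S : Pt 8 → Pt 8 → ℝ, (∀ e e', 0 ≤ S e e') ∧
      (∀ V W : Finset (Pt 8), IsUpperSet (V : Set (Pt 8)) → IsUpperSet (W : Set (Pt 8)) →
        0 ≤ A1form 8 piOne8 (setInd C8set) (setInd V) (setInd W) - Sform S (setInd V) (setInd W)) ∧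
      (∀ V W : Finset (Pt 8), IsUpperSet (V : Set (Pt 8)) → IsUpperSet (W : Set (Pt 8)) →
        0 ≤ Sform S (setInd V) (setInd W) + A2form 8 piOne8 (setInd C8set) (setInd V) (setInd W)) := by
  rintro ⟨S, hS, hU, hL⟩
  -- instantiated rows
  have rowU : ∀ T T' : List (Fin 8), SformW S (wBox T T') ≤ (c0Z piOne8 c8B (cylB T) (cylB T') : ℝ) := by
    intro T T'
    have h := hU (cyl T) (cyl T') (isUpperSet_cyl T) (isUpperSet_cyl T')
    rw [A1form_eq_N1form_zero] at h
    unfold C8set cyl at h; rw [N1form_zero_eq_c0Z] at h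
    rw [Sform_eq_SformW] at h
    unfold wBox cyl; linarith
  have rowL : ∀ T T' : List (Fin 8), -(r0Z piOne8 c8B (cylB T) (cylB T') : ℝ) ≤ SformW S (wBox T T') := by
    intro T T'
    have h := hL (cyl T) (cyl T') (isUpperSet_cyl T) (isUpperSet_cyl T')
    rw [A2form_eq_N2form_zero] at h
    unfold C8set cyl at h; rw [N2form_zero_eq_r0Z] at h
    rw [Sform_eq_SformW] at h
    unfold wBox cyl; linarith
  -- (L): the four pair-splitting boxes carry ≥ 1000
  have hLsum : (1000 : ℝ) ≤ (boxesL.map fun b => SformW S (wBox b.1 b.2)).sum := by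
    simp only [boxesL, List.map_cons, List.map_nil, List.sum_cons, List.sum_nil]
    have b0 := rowL [1] [0]; have b1 := rowL [3] [2]; have b2 := rowL [5] [4]; have b3 := rowL [7] [6]
    rw [r0Z_p0] at b0; rw [r0Z_p1] at b1; rw [r0Z_p2] at b2; rw [r0Z_p3] at b3
    push_cast at b0 b1 b2 b3
    linarith
  -- (U): the six pair boxes carry ≤ 300, the whole cube ≤ 625
  have hUsum : (boxesU.map fun b => SformW S (wBox b.1 b.2)).sum ≤ 300 := by
    simp only [boxesU, List.map_cons, List.map_nil, List.sum_cons, List.sum_nil]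
    have a0 := rowU [1, 3] [0, 2]; have a1 := rowU [1, 5] [0, 4]; have a2 := rowU [1, 7] [0, 6]
    have a3 := rowU [3, 5] [2, 4]; have a4 := rowU [3, 7] [2, 6]; have a5 := rowU [5, 7] [4, 6]
    rw [c0Z_box01] at a0; rw [c0Z_box02] at a1; rw [c0Z_box03] at a2; rw [c0Z_box12] at a3; rw [c0Z_box13] at a4; rw [c0Z_box23] at a5
    push_cast at a0 a1 a2 a3 a4 a5
    linarith
  have hAll : SformW S (wBox [] []) ≤ 625 := by
    have a := rowU [] []; rw [c0Z_all] at a; push_cast at a; exact a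
  -- pointwise domination: L-count ≤ 1 + U-count, with S ≥ 0
  have hD : (boxesL.map fun b => SformW S (wBox b.1 b.2)).sum ≤ SformW S (wBox [] []) + (boxesU.map fun b => SformW S (wBox b.1 b.2)).sum := by
    rw [SformW_boxes, SformW_boxes, ← SformW_add]
    refine SformW_mono hS fun p => ?_
    have hw : wBox [] [] p = 1 := by simp [wBox, cyl, cylB, setInd_apply]
    simp only [Pi.add_apply, hw]
    exact_mod_cast boxCount_dominate p
  linarith

end Summit.CriticalPhenomena.PercolationContinuityZ3.Theorems.SahiThreeCopy
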